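import Mathlib
import Literature.Geometry.Symplectic.JHolomorphicCuspDoublePointsDesign
import Literature.Geometry.Symplectic.JHolomorphicCuspDoublePointsModel
import Literature.AlgebraicTopology.SingularHomology.LocalDegreeSum
import Literature.Analysis.Calculus.LocalDegreeFormula
import HarnessLib

/-!
# Double points of perturbed cusps, III: the degree argument

Third file of the flat-model proof of D. McDuff's theorem that `C¹`-small `J`-holomorphic
immersed perturbations of a cuspidal `J`-holomorphic disc have double points (D. McDuff, *The
local behaviour of holomorphic curves in almost complex 4-manifolds*, J. Differential Geom. 34
(1991), Thm 1.4 with Cor. 4.4 and (5.6); plan in the header of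
`JHolomorphicCuspDoublePointsDesign.lean`). Here the topology is done, entirely through the
index theorem `Literature.AlgebraicTopology.SingularHomology.sum_detSign_eq_zero` (Milnor,
*Topology from the Differentiable Viewpoint*, §6): a field on an open set of `ℝ⁴` which deforms,
its zeros staying in a compact set, to a zero-free field has index sum zero.

* `exists_transversality_margin`, `ne_of_transversal`, `exists_injectivity_margin`,
  `exists_oscillation_lt` — the elementary compactness / mean-value estimates saying that an
  injective immersion `h` with a push-off field `e` nowhere tangent to it has NO solutions of
  `h z - h w = ε e(w)` (near the diagonal by transversality, far from it by injectivity).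
* `sum_detSign_eq_zero_complexProd` — the index theorem transported to `ℂ × ℂ`.
* `not_injOn_of_perturbed_cusp` — **the main theorem** (McDuff's Thm 1.4 in the flat chart of
  the cusp, topological form): for the cusp `F(z) = (zᵏ, û z)` with aligned branch differences
  and a reference push-off field on a boundary collar whose second component winds `N` times,
  `|N| < Σ_μ m_μ`, every `C¹`-close injective immersion `g` with a nowhere-tangent push-off field
  close to the reference one on the collar is NOT injective: the map
  `(z, w) ↦ g z - g w - ε e(w)` on the bidisc is zero-free, yet it deforms with compactly
  contained zeros (maps `(1-t)F + tg`, then fields, then the second component) to the model map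
  of `JHolomorphicCuspDoublePointsModel.lean`, whose index sum is `Σ_μ m_μ + N ≠ 0`.

The remaining, analytic, steps of McDuff's theorem (the normal form `(zᵏ, û)` of a
`J`-holomorphic critical point with holomorphic leading terms of the branch differences — Wendl,
*Lectures on Contact 3-Manifolds, Holomorphic Curves and Intersection Theory* (2020), Thm B.23 —
and the complex-normal push-off field with `|N| = k - 1`) are not in this file.

Everything is proved; there are no definitions and no named facts.

## References

* D. McDuff, *The local behaviour of holomorphic curves in almost complex 4-manifolds*,
  J. Differential Geom. 34 (1991) 143–164, Thm 1.4, Cor. 4.4, (5.6). [McDuff1991LocalBehaviour]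
* J. Milnor, *Topology from the Differentiable Viewpoint* (1965), §5 Lemma 1, §6 Lemma 4 and
  Thm. 1. [MilnorTDV1965]
* C. Wendl, *Lectures on Contact 3-Manifolds, Holomorphic Curves and Intersection Theory*,
  Cambridge Tracts in Math. 220 (2020), App. B, Thm B.23. [Wendl2020]
-/

noncomputable section

open scoped Real ComplexConjugate Topology
open Complex Set Filter Metric Literature.Topology.PlaneTopology

namespace Literature.Geometry.Symplectic

namespace CuspDoublePoints

/-! ### Generic estimates -/

section Estimates

variable {V : Type*} [NormedAddCommGroup V] [NormedSpace ℝ V]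

/-- **Transversality margin by compactness.** If, for every parameter `p` in a compact set, the
real-linear map `A p : ℂ → V` is injective and the vector `b p` is not in its range, and `A`, `b`
are continuous on the parameter set, then `‖A p v - t • b p‖ ≥ c (‖v‖ + |t|)` for a uniform
`c > 0`. [folklore] -/
theorem exists_transversality_margin {P : Type*} [TopologicalSpace P] {Kp : Set P}
    (hKp : IsCompact Kp) {A : P → ℂ →L[ℝ] V} {b : P → V} (hA : ContinuousOn A Kp)
    (hb : ContinuousOn b Kp) (hinj : ∀ p ∈ Kp, Function.Injective (A p))
    (hnot : ∀ p ∈ Kp, b p ∉ LinearMap.range (A p : ℂ →ₗ[ℝ] V)) :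
    ∃ c > 0, ∀ p ∈ Kp, ∀ (v : ℂ) (t : ℝ), c * (‖v‖ + |t|) ≤ ‖A p v - t • b p‖ := by
  -- the unit sphere of `ℂ × ℝ` for the norm `‖v‖ + |t|`
  set Sph : Set (ℂ × ℝ) := {q | ‖q.1‖ + |q.2| = 1} with hSph
  have hSphc : IsCompact Sph := by
    refine Metric.isCompact_of_isClosed_isBounded ?_ ?_
    · exact isClosed_eq (continuous_norm.comp continuous_fst |>.add
        (continuous_abs.comp continuous_snd)) continuous_const
    · refine (Metric.isBounded_closedBall (x := (0 : ℂ × ℝ)) (r := 1)).subset ?_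
      intro q hq
      simp only [mem_closedBall, dist_zero_right, Prod.norm_def, Real.norm_eq_abs]
      have : ‖q.1‖ + |q.2| = 1 := hq
      exact max_le (by linarith [abs_nonneg q.2]) (by linarith [norm_nonneg q.1])
  rcases (Kp ×ˢ Sph).eq_empty_or_nonempty with hempty | hne
  · -- degenerate case: no parameters or (impossible) empty sphere
    refine ⟨1, one_pos, fun p hp v t => ?_⟩
    rcases eq_or_ne (‖v‖ + |t|) 0 with h0 | h0
    · rw [h0, mul_zero]; exact norm_nonneg _
    · exfalso
      have hmem : (p, ((‖v‖ + |t|)⁻¹ • v, (‖v‖ + |t|)⁻¹ * t)) ∈ Kp ×ˢ Sph := by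
        refine ⟨hp, ?_⟩
        have hpos : 0 < ‖v‖ + |t| := lt_of_le_of_ne (by positivity) (Ne.symm h0)
        simp only [hSph, mem_setOf_eq, norm_smul, norm_inv, Real.norm_of_nonneg hpos.le, abs_mul,
          abs_inv, abs_of_pos hpos]
        field_simp
      rw [hempty] at hmem
      exact hmem
  · set f : P × (ℂ × ℝ) → ℝ := fun q => ‖A q.1 q.2.1 - q.2.2 • b q.1‖ with hf
    have hfc : ContinuousOn f (Kp ×ˢ Sph) := by
      have h1 : ContinuousOn (fun q : P × (ℂ × ℝ) => A q.1 q.2.1) (Kp ×ˢ Sph) := by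
        have hA' : ContinuousOn (fun q : P × (ℂ × ℝ) => A q.1) (Kp ×ˢ Sph) :=
          hA.comp continuous_fst.continuousOn fun q hq => hq.1
        exact hA'.clm_apply (continuous_fst.comp continuous_snd).continuousOn
      have h2 : ContinuousOn (fun q : P × (ℂ × ℝ) => q.2.2 • b q.1) (Kp ×ˢ Sph) :=
        (continuous_snd.comp continuous_snd).continuousOn.smul
          (hb.comp continuous_fst.continuousOn fun q hq => hq.1)
      exact (h1.sub h2).norm
    obtain ⟨q₀, hq₀, hmin⟩ := (hKp.prod hSphc).exists_isMinOn hne hfc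
    have hpos : 0 < f q₀ := by
      rcases (norm_nonneg _ : 0 ≤ f q₀).lt_or_eq with h | h
      · exact h
      · exfalso
        have h0 : A q₀.1 q₀.2.1 = q₀.2.2 • b q₀.1 := by
          have : ‖A q₀.1 q₀.2.1 - q₀.2.2 • b q₀.1‖ = 0 := h.symm
          exact sub_eq_zero.1 (norm_eq_zero.1 this)
        rcases eq_or_ne q₀.2.2 0 with ht | ht
        · rw [ht, zero_smul] at h0
          have hv : q₀.2.1 = 0 := hinj q₀.1 hq₀.1 (by rw [h0, map_zero])
          have : ‖q₀.2.1‖ + |q₀.2.2| = 1 := hq₀.2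
          rw [hv, ht, norm_zero, abs_zero, add_zero] at this
          exact zero_ne_one this
        · apply hnot q₀.1 hq₀.1
          refine ⟨(q₀.2.2)⁻¹ • q₀.2.1, ?_⟩
          rw [ContinuousLinearMap.coe_coe, map_smul, h0, smul_smul, inv_mul_cancel₀ ht, one_smul]
    refine ⟨f q₀, hpos, fun p hp v t => ?_⟩
    rcases eq_or_ne (‖v‖ + |t|) 0 with h0 | h0
    · rw [h0, mul_zero]; exact norm_nonneg _
    · have hRpos : 0 < ‖v‖ + |t| := lt_of_le_of_ne (by positivity) (Ne.symm h0)
      have hmem : (p, ((‖v‖ + |t|)⁻¹ • v, (‖v‖ + |t|)⁻¹ * t)) ∈ Kp ×ˢ Sph := by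
        refine ⟨hp, ?_⟩
        simp only [hSph, mem_setOf_eq, norm_smul, norm_inv, Real.norm_of_nonneg hRpos.le, abs_mul,
          abs_inv, abs_of_pos hRpos]
        field_simp
      have hle : f q₀ ≤ f (p, ((‖v‖ + |t|)⁻¹ • v, (‖v‖ + |t|)⁻¹ * t)) := hmin hmem
      have hscale : A p ((‖v‖ + |t|)⁻¹ • v) - ((‖v‖ + |t|)⁻¹ * t) • b p =
          (‖v‖ + |t|)⁻¹ • (A p v - t • b p) := by
        rw [map_smul, smul_sub, smul_smul]
      have hle' : f q₀ ≤ (‖v‖ + |t|)⁻¹ * ‖A p v - t • b p‖ := by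
        have : f (p, ((‖v‖ + |t|)⁻¹ • v, (‖v‖ + |t|)⁻¹ * t)) =
            (‖v‖ + |t|)⁻¹ * ‖A p v - t • b p‖ := by
          simp only [hf, hscale, norm_smul, norm_inv, Real.norm_of_nonneg hRpos.le]
        rw [← this]; exact hle
      have := mul_le_mul_of_nonneg_left hle' hRpos.le
      rwa [← mul_assoc, mul_inv_cancel₀ h0, one_mul, mul_comm] at this

/-- **No solutions of `h z - h w = ε e(w)` near the diagonal** when the field is quantitatively
transverse to `dh(w)` with a margin exceeding the oscillation of `dh` on the segment `[w, z]`.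
[folklore] -/
theorem ne_of_transversal {h : ℂ → V} {S : Set ℂ} (hS : Convex ℝ S) {z w : ℂ} (hz : z ∈ S)
    (hw : w ∈ S) (hdiff : ∀ x ∈ S, DifferentiableAt ℝ h x) {ω c : ℝ}
    (hω : ∀ x ∈ S, ‖fderiv ℝ h x - fderiv ℝ h w‖ ≤ ω) {e : V}
    (hc : ∀ (v : ℂ) (t : ℝ), c * (‖v‖ + |t|) ≤ ‖fderiv ℝ h w v - t • e‖) (hωc : ω < c)
    {ε : ℝ} (hε : 0 < ε) : h z - h w ≠ ε • e := by
  intro heq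
  have hmv : ‖h z - h w - fderiv ℝ h w (z - w)‖ ≤ ω * ‖z - w‖ :=
    hS.norm_image_sub_le_of_norm_fderiv_le' hdiff hω hw hz
  rw [heq] at hmv
  have h1 := hc (z - w) ε
  rw [abs_of_pos hε, mul_add] at h1
  have h2 : ‖fderiv ℝ h w (z - w) - ε • e‖ = ‖ε • e - fderiv ℝ h w (z - w)‖ := norm_sub_rev _ _
  have hω0 : 0 ≤ ω := by simpa using hω w hw
  have hc0 : 0 < c := hω0.trans_lt hωc
  have h3 := mul_nonneg (sub_nonneg.2 hωc.le) (norm_nonneg (z - w))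
  rw [sub_mul] at h3
  linarith [mul_pos hc0 hε]

omit [NormedSpace ℝ V] in
/-- **Injectivity margin by compactness.** An injective continuous map on a compact set
separates points at distance `≥ θ` by a uniform `γ > 0`. [folklore] -/
theorem exists_injectivity_margin {h : ℂ → V} {Kc : Set ℂ} (hKc : IsCompact Kc)
    (hh : ContinuousOn h Kc) (hinj : InjOn h Kc) {θ : ℝ} (hθ : 0 < θ) :
    ∃ γ > 0, ∀ z ∈ Kc, ∀ w ∈ Kc, θ ≤ ‖z - w‖ → γ ≤ ‖h z - h w‖ := by
  set D : Set (ℂ × ℂ) := {q | q.1 ∈ Kc ∧ q.2 ∈ Kc ∧ θ ≤ ‖q.1 - q.2‖} with hD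
  have hDc : IsCompact D := by
    have : D = (Kc ×ˢ Kc) ∩ {q : ℂ × ℂ | θ ≤ ‖q.1 - q.2‖} := by
      ext q; simp only [hD, mem_setOf_eq, mem_inter_iff, mem_prod]; tauto
    rw [this]
    exact (hKc.prod hKc).inter_right
      (isClosed_le continuous_const (continuous_norm.comp (continuous_fst.sub continuous_snd)))
  rcases D.eq_empty_or_nonempty with hempty | hne
  · refine ⟨1, one_pos, fun z hz w hw hzw => ?_⟩
    have : (z, w) ∈ D := ⟨hz, hw, hzw⟩
    rw [hempty] at this; exact this.elim
  · have hfc : ContinuousOn (fun q : ℂ × ℂ => ‖h q.1 - h q.2‖) D :=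
      ((hh.comp continuous_fst.continuousOn fun q hq => hq.1).sub
        (hh.comp continuous_snd.continuousOn fun q hq => hq.2.1)).norm
    obtain ⟨q₀, hq₀, hmin⟩ := hDc.exists_isMinOn hne hfc
    have hpos : 0 < ‖h q₀.1 - h q₀.2‖ := by
      refine norm_pos_iff.2 (sub_ne_zero.2 fun heq => ?_)
      have := hinj hq₀.1 hq₀.2.1 heq
      have h3 := hq₀.2.2
      rw [this, sub_self, norm_zero] at h3
      exact not_lt.2 h3 hθ
    exact ⟨_, hpos, fun z hz w hw hzw => hmin (show (z, w) ∈ D from ⟨hz, hw, hzw⟩)⟩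

/-- **Oscillation of a continuous derivative.** A function continuous on a compact set varies by
less than any `c > 0` at a uniform scale `θ`. [folklore] -/
theorem exists_oscillation_lt {W : Type*} [NormedAddCommGroup W] {φ : ℂ → W} {Kc : Set ℂ}
    (hKc : IsCompact Kc) (hφ : ContinuousOn φ Kc) {c : ℝ} (hc : 0 < c) :
    ∃ θ > 0, ∀ x ∈ Kc, ∀ y ∈ Kc, ‖x - y‖ ≤ θ → ‖φ x - φ y‖ ≤ c := by
  have huc := hKc.uniformContinuousOn_of_continuous hφ
  rw [Metric.uniformContinuousOn_iff] at huc
  obtain ⟨δ, hδ, hδc⟩ := huc c hc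
  refine ⟨δ / 2, by positivity, fun x hx y hy hxy => ?_⟩
  have : dist x y < δ := by rw [dist_eq_norm]; linarith
  have := hδc x hx y hy this
  rw [dist_eq_norm] at this
  exact this.le

end Estimates

/-! ### The degree theorem transported to `ℂ × ℂ` -/

/-- `Literature.AlgebraicTopology.SingularHomology.sum_detSign_eq_zero` (Milnor TDV §6: the index
sum of a field that deforms, without zeros escaping a compact set, to a zero-free field
vanishes) transported from `ℝ⁴` to `ℂ × ℂ` along a linear identification.
[cite: MilnorTDV1965, §6 Lemma 4 (p. 37) and Thm. 1 (p. 38)] -/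
theorem sum_detSign_eq_zero_complexProd {O : Set (ℂ × ℂ)} (hO : IsOpen O) {K : Set (ℂ × ℂ)}
    (hK : IsCompact K) (hKO : K ⊆ O) (F : ℝ → (ℂ × ℂ) → ℂ × ℂ)
    (hF : ContinuousOn (fun p : ℝ × (ℂ × ℂ) => F p.1 p.2) (univ ×ˢ O))
    (hFK : ∀ t ∈ Icc (0 : ℝ) 1, ∀ x ∈ O, F t x = 0 → x ∈ K)
    (hF1 : ∀ x ∈ O, F 1 x ≠ 0)
    (Z : Finset (ℂ × ℂ)) (hZ : ∀ x ∈ O, F 0 x = 0 ↔ x ∈ Z) (hZO : (↑Z : Set (ℂ × ℂ)) ⊆ O)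
    (A : (ℂ × ℂ) → ((ℂ × ℂ) →L[ℝ] (ℂ × ℂ))) (hA : ∀ z ∈ Z, HasFDerivAt (F 0) (A z) z)
    (hdet : ∀ z ∈ Z, LinearMap.det (A z : (ℂ × ℂ) →ₗ[ℝ] (ℂ × ℂ)) ≠ 0) :
    ∑ z ∈ Z, (if 0 < LinearMap.det (A z : (ℂ × ℂ) →ₗ[ℝ] (ℂ × ℂ)) then (1 : ℤ) else -1) = 0 := by
  classical
  have hfin : Module.finrank ℝ (EuclideanSpace ℝ (Fin 4)) = Module.finrank ℝ (ℂ × ℂ) := by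
    rw [finrank_euclideanSpace, Fintype.card_fin, Module.finrank_prod, Complex.finrank_real_complex]
  set T : EuclideanSpace ℝ (Fin 4) ≃L[ℝ] ℂ × ℂ := ContinuousLinearEquiv.ofFinrankEq hfin with hT
  set F' : ℝ → EuclideanSpace ℝ (Fin 4) → EuclideanSpace ℝ (Fin 4) :=
    fun t x => T.symm (F t (T x)) with hF'
  have hO' : IsOpen (T ⁻¹' O) := hO.preimage T.continuous
  have hK' : IsCompact (T ⁻¹' K) := by
    rw [← T.image_symm_eq_preimage K]; exact hK.image T.symm.continuous
  have hK'O : T ⁻¹' K ⊆ T ⁻¹' O := preimage_mono hKO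
  have hcont' : ContinuousOn (fun p : ℝ × EuclideanSpace ℝ (Fin 4) => F' p.1 p.2)
      (univ ×ˢ (T ⁻¹' O)) := by
    have h1 : ContinuousOn (fun p : ℝ × EuclideanSpace ℝ (Fin 4) => (p.1, T p.2)) (univ ×ˢ (T ⁻¹' O)) :=
      (continuous_fst.prodMk (T.continuous.comp continuous_snd)).continuousOn
    have h2 := hF.comp h1 (fun p hp => ⟨mem_univ _, hp.2⟩)
    exact T.symm.continuous.comp_continuousOn h2
  have hFK' : ∀ t ∈ Icc (0 : ℝ) 1, ∀ x ∈ T ⁻¹' O, F' t x = 0 → x ∈ T ⁻¹' K := by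
    intro t ht x hx h0
    have : F t (T x) = 0 := by simpa [hF'] using h0
    exact hFK t ht (T x) hx this
  have hF1' : ∀ x ∈ T ⁻¹' O, F' 1 x ≠ 0 := by
    intro x hx h0
    have : F 1 (T x) = 0 := by simpa [hF'] using h0
    exact hF1 (T x) hx this
  set Z' : Finset (EuclideanSpace ℝ (Fin 4)) := Z.image T.symm with hZ'
  have hmemZ' : ∀ x, x ∈ Z' ↔ T x ∈ Z := by
    intro x
    simp only [hZ', Finset.mem_image]
    constructor
    · rintro ⟨z, hz, rfl⟩; simpa using hz
    · intro hx; exact ⟨T x, hx, by simp⟩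
  have hZ'' : ∀ x ∈ T ⁻¹' O, F' 0 x = 0 ↔ x ∈ Z' := by
    intro x hx
    rw [hmemZ', ← hZ (T x) hx]
    simp [hF']
  have hZ'O : (↑Z' : Set (EuclideanSpace ℝ (Fin 4))) ⊆ T ⁻¹' O := by
    intro x hx
    exact hZO ((hmemZ' x).1 hx)
  set A' : EuclideanSpace ℝ (Fin 4) → (EuclideanSpace ℝ (Fin 4) →L[ℝ] EuclideanSpace ℝ (Fin 4)) :=
    fun x => (T.symm : ℂ × ℂ →L[ℝ] EuclideanSpace ℝ (Fin 4)).comp ((A (T x)).comp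
      (T : EuclideanSpace ℝ (Fin 4) →L[ℝ] ℂ × ℂ)) with hA'
  have hA'' : ∀ x ∈ Z', HasFDerivAt (F' 0) (A' x) x := by
    intro x hx
    have h1 : HasFDerivAt (F 0) (A (T x)) (T x) := hA _ ((hmemZ' x).1 hx)
    have h2 := h1.comp x T.hasFDerivAt
    exact T.symm.hasFDerivAt.comp x h2
  have hdetA' : ∀ x, LinearMap.det (A' x : EuclideanSpace ℝ (Fin 4) →ₗ[ℝ] EuclideanSpace ℝ (Fin 4)) =
      LinearMap.det (A (T x) : (ℂ × ℂ) →ₗ[ℝ] (ℂ × ℂ)) := by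
    intro x
    have : (A' x : EuclideanSpace ℝ (Fin 4) →ₗ[ℝ] EuclideanSpace ℝ (Fin 4)) =
        (T.symm.toLinearEquiv : (ℂ × ℂ) →ₗ[ℝ] EuclideanSpace ℝ (Fin 4)) ∘ₗ
          (A (T x) : (ℂ × ℂ) →ₗ[ℝ] (ℂ × ℂ)) ∘ₗ
          (T.symm.toLinearEquiv.symm : EuclideanSpace ℝ (Fin 4) →ₗ[ℝ] (ℂ × ℂ)) := by
      apply LinearMap.ext; intro v; simp [hA']
    rw [this, LinearMap.det_conj]
  have hdet' : ∀ x ∈ Z', LinearMap.det (A' x : EuclideanSpace ℝ (Fin 4) →ₗ[ℝ] EuclideanSpace ℝ (Fin 4)) ≠ 0 := by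
    intro x hx; rw [hdetA']; exact hdet _ ((hmemZ' x).1 hx)
  have h := Literature.AlgebraicTopology.SingularHomology.sum_detSign_eq_zero (by norm_num) hO' hK'
    hK'O F' hcont' hFK' hF1' Z' hZ'' hZ'O A' hA'' hdet'
  rw [hZ', Finset.sum_image (fun z _ z' _ h => T.symm.injective h)] at h
  simp only [hdetA', ContinuousLinearEquiv.apply_symm_apply] at h
  exact h

/-! ### The main theorem: perturbed cusps have double points -/

/-- **Immersed perturbations of a cusp are not injective** (D. McDuff 1991, Thm 1.4 with
Cor. 4.4 and (5.6), flat model form: "`Int(f_εx) = L.Int(f, 0)` so that `f_εx` is not an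
embedding"). Data: the cusp `F(z) = (zᵏ, û z)` (`k ≥ 2`, `û ∈ C¹`) on the closed disc `‖z‖ ≤ s`,
injective there, whose branch differences are aligned with holomorphic leading terms,
`|û z - û(μz) + C_μ z^{m_μ}| ≤ |C_μ| |z|^{m_μ} / 2` for the `k`-th roots of unity `μ ≠ 1`
(`C_μ ≠ 0`, `m_μ ≥ k - 1`; Wendl 2020, Thm B.23), and a continuous reference push-off field
`e_ref` on the collar `s - θ₀ ≤ ‖w‖ ≤ s` such that all the vectors `(l e_ref¹, e_ref²)`,
`0 ≤ l ≤ 1`, are transverse to the tangent planes `dF(w)(ℂ)` of the cusp and whose second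
component winds `N` times along the inner circle of the collar, with `|N| < Σ_μ m_μ`.
CONCLUSION: there is `δ₀ > 0` such that no `C¹` map `g`, `δ₀`-close to `F` in `C¹` on the disc,
with injective differentials and admitting a continuous push-off field `e` nowhere tangent to `g`
on the disc and `δ₀`-close to `e_ref` on the collar, is injective on the disc.
PROOF: the index sum of `(z, w) ↦ g z - g w - ε e(w)` on the bidisc vanishes (no zeros at all),
and it deforms — through `h_t = (1-t) F + t g`, then through push-off fields to `(0, et₂)` with
`et₂` the designed field of `exists_designField`, then through the second component to the model
map of `model_package` — without zeros reaching the boundary of the bidisc, to a map whose index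
sum is `Σ_μ m_μ + N ≠ 0`; this contradicts
`Literature.AlgebraicTopology.SingularHomology.sum_detSign_eq_zero` (Milnor TDV §6).
[cite: McDuff1991LocalBehaviour, Thm 1.4, Cor. 4.4, (5.6)] -/
theorem not_injOn_of_perturbed_cusp {k : ℕ} (hk : 2 ≤ k) {C : ℂ → ℂ} {m : ℂ → ℕ}
    (hC : ∀ μ ∈ (Polynomial.nthRootsFinset k (1 : ℂ)).erase 1, C μ ≠ 0)
    (hm : ∀ μ ∈ (Polynomial.nthRootsFinset k (1 : ℂ)).erase 1, k - 1 ≤ m μ)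
    {N : ℤ} (hN : (N.natAbs : ℤ) < ∑ μ ∈ (Polynomial.nthRootsFinset k (1 : ℂ)).erase 1, (m μ : ℤ))
    {û : ℂ → ℂ} {U : Set ℂ} (hU : IsOpen U) {s : ℝ} (hs : 0 < s) (hsU : closedBall 0 s ⊆ U)
    (hû : ContDiffOn ℝ 1 û U)
    (halign : ∀ μ ∈ (Polynomial.nthRootsFinset k (1 : ℂ)).erase 1, ∀ z : ℂ, ‖z‖ ≤ s →
      ‖û z - û (μ * z) + C μ * z ^ m μ‖ ≤ ‖C μ‖ * ‖z‖ ^ m μ / 2)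
    (hinj : InjOn (fun z : ℂ => ((z ^ k, û z) : ℂ × ℂ)) (closedBall 0 s))
    {e_ref : ℂ → ℂ × ℂ} {θ₀ : ℝ} (hθ₀ : 0 < θ₀) (hθ₀s : θ₀ < s)
    (he_ref : ContinuousOn e_ref {w | s - θ₀ ≤ ‖w‖ ∧ ‖w‖ ≤ s})
    (hFinj : ∀ w : ℂ, s - θ₀ ≤ ‖w‖ → ‖w‖ ≤ s →
      Function.Injective (fderiv ℝ (fun z : ℂ => ((z ^ k, û z) : ℂ × ℂ)) w))
    (htrans : ∀ w : ℂ, s - θ₀ ≤ ‖w‖ → ‖w‖ ≤ s → ∀ l ∈ Icc (0 : ℝ) 1,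
      (((l : ℂ) * (e_ref w).1, (e_ref w).2) : ℂ × ℂ) ∉ LinearMap.range
        (fderiv ℝ (fun z : ℂ => ((z ^ k, û z) : ℂ × ℂ)) w : ℂ →ₗ[ℝ] ℂ × ℂ))
    (hwind : wind (fun t => (e_ref (circleLoop 0 (s - θ₀) t)).2) = N) :
    ∃ δ₀ > 0, ∀ (g : ℂ → ℂ × ℂ) (e : ℂ → ℂ × ℂ), ContDiffOn ℝ 1 g U →
      (∀ w ∈ closedBall (0 : ℂ) s, ‖g w - (w ^ k, û w)‖ ≤ δ₀) →
      (∀ w ∈ closedBall (0 : ℂ) s,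
        ‖fderiv ℝ g w - fderiv ℝ (fun z : ℂ => ((z ^ k, û z) : ℂ × ℂ)) w‖ ≤ δ₀) →
      (∀ w ∈ closedBall (0 : ℂ) s, Function.Injective (fderiv ℝ g w)) →
      ContinuousOn e (closedBall 0 s) →
      (∀ w ∈ closedBall (0 : ℂ) s, e w ∉ LinearMap.range (fderiv ℝ g w : ℂ →ₗ[ℝ] ℂ × ℂ)) →
      (∀ w : ℂ, s - θ₀ ≤ ‖w‖ → ‖w‖ ≤ s → ‖e w - e_ref w‖ ≤ δ₀) →
      ¬ InjOn g (closedBall 0 s) := by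
  classical
  -- ### notation
  set Rk := Polynomial.nthRootsFinset k (1 : ℂ) with hRk
  set S := Rk.erase 1 with hS
  set F : ℂ → ℂ × ℂ := fun z => (z ^ k, û z) with hFdef
  set Kb : Set ℂ := closedBall 0 s with hKb
  set Col₀ : Set ℂ := {w | s - θ₀ ≤ ‖w‖ ∧ ‖w‖ ≤ s} with hCol₀
  have hKbc : IsCompact Kb := isCompact_closedBall _ _
  have hCol₀K : Col₀ ⊆ Kb := fun w hw => mem_closedBall_zero_iff.2 hw.2
  have hCol₀c : IsCompact Col₀ := by
    have : Col₀ = Kb ∩ {w | s - θ₀ ≤ ‖w‖} := by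
      ext w; simp only [hCol₀, hKb, mem_setOf_eq, mem_inter_iff, mem_closedBall_zero_iff]; tauto
    rw [this]; exact hKbc.inter_right (isClosed_le continuous_const continuous_norm)
  have hk0 : 0 < k := by omega
  -- ### regularity of the cusp
  have hFcd : ContDiffOn ℝ 1 F U := by
    refine ContDiffOn.prodMk ?_ hû
    exact (contDiff_id.pow k).contDiffOn
  have hFd : ∀ x ∈ Kb, DifferentiableAt ℝ F x := fun x hx =>
    (hFcd.differentiableOn_one x (hsU hx)).differentiableAt (hU.mem_nhds (hsU hx))
  have hFc : ContinuousOn F Kb := hFcd.continuousOn.mono hsU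
  have hdFc : ContinuousOn (fderiv ℝ F) Kb := (hFcd.continuousOn_fderiv_of_isOpen hU le_rfl).mono hsU
  -- ### the transversality margin of the reference field
  obtain ⟨c₁, hc₁, hc₁le⟩ : ∃ c > 0, ∀ q ∈ Col₀ ×ˢ Icc (0 : ℝ) 1, ∀ (v : ℂ) (t : ℝ),
      c * (‖v‖ + |t|) ≤ ‖fderiv ℝ F q.1 v - t • (((q.2 : ℂ) * (e_ref q.1).1, (e_ref q.1).2) : ℂ × ℂ)‖ := by
    refine exists_transversality_margin (hCol₀c.prod isCompact_Icc) ?_ ?_ ?_ ?_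
    · exact hdFc.comp continuous_fst.continuousOn fun q hq => hCol₀K hq.1
    · have h1 : ContinuousOn (fun q : ℂ × ℝ => e_ref q.1) (Col₀ ×ˢ Icc (0 : ℝ) 1) :=
        he_ref.comp continuous_fst.continuousOn fun q hq => hq.1
      refine ContinuousOn.prodMk ?_ (continuous_snd.comp_continuousOn h1)
      exact ((continuous_ofReal.comp continuous_snd).continuousOn).mul
        (continuous_fst.comp_continuousOn h1)
    · rintro ⟨w, l⟩ ⟨hw, _⟩; exact hFinj w hw.1 hw.2
    · rintro ⟨w, l⟩ ⟨hw, hl⟩; exact htrans w hw.1 hw.2 l hl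
  -- ### the second component of the reference field is bounded below on the collar
  obtain ⟨mr, hmr, hmrle⟩ : ∃ mr > 0, ∀ w ∈ Col₀, mr ≤ ‖(e_ref w).2‖ := by
    have hne : ∀ w ∈ Col₀, (e_ref w).2 ≠ 0 := by
      intro w hw h0
      apply htrans w hw.1 hw.2 0 ⟨le_rfl, zero_le_one⟩
      refine ⟨0, ?_⟩
      rw [map_zero, h0]; ext <;> simp
    rcases Col₀.eq_empty_or_nonempty with hemp | hne'
    · exact ⟨1, one_pos, fun w hw => by rw [hemp] at hw; exact hw.elim⟩
    · have hcont : ContinuousOn (fun w => ‖(e_ref w).2‖) Col₀ :=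
        (continuous_snd.comp_continuousOn he_ref).norm
      obtain ⟨w₀, hw₀, hmin⟩ := hCol₀c.exists_isMinOn hne' hcont
      exact ⟨‖(e_ref w₀).2‖, norm_pos_iff.2 (hne w₀ hw₀), fun w hw => hmin hw⟩
  -- ### scales
  obtain ⟨θF, hθF, hθFle⟩ := exists_oscillation_lt hKbc hdFc (show 0 < c₁ / 4 by positivity)
  set θd : ℝ := min (θ₀ / 4) θF with hθd
  have hθd0 : 0 < θd := lt_min (by positivity) hθF
  have hθdθ₀ : θd ≤ θ₀ / 4 := min_le_left _ _
  have hθdF : θd ≤ θF := min_le_right _ _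
  obtain ⟨γF, hγF, hγFle⟩ := exists_injectivity_margin hKbc hFc hinj hθd0
  -- ### the closeness constant
  set δ₀ : ℝ := min (c₁ / 8) (min (γF / 4) (mr / 2)) with hδ₀
  have hδ₀pos : 0 < δ₀ := lt_min (by positivity) (lt_min (by positivity) (by positivity))
  have hδ₀c : δ₀ ≤ c₁ / 8 := min_le_left _ _
  have hδ₀γ : δ₀ ≤ γF / 4 := (min_le_right _ _).trans (min_le_left _ _)
  have hδ₀m : δ₀ ≤ mr / 2 := (min_le_right _ _).trans (min_le_right _ _)
  refine ⟨δ₀, hδ₀pos, ?_⟩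
  intro g e hg hg0 hg1 hgimm hec hetan heclose hginj
  -- ### regularity of the perturbation
  have hgd : ∀ x ∈ Kb, DifferentiableAt ℝ g x := fun x hx =>
    (hg.differentiableOn_one x (hsU hx)).differentiableAt (hU.mem_nhds (hsU hx))
  have hgc : ContinuousOn g Kb := hg.continuousOn.mono hsU
  have hdgc : ContinuousOn (fderiv ℝ g) Kb := (hg.continuousOn_fderiv_of_isOpen hU le_rfl).mono hsU
  -- margin, scale and injectivity margin of `g`
  obtain ⟨cg, hcg, hcgle⟩ : ∃ c > 0, ∀ w ∈ Kb, ∀ (v : ℂ) (t : ℝ),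
      c * (‖v‖ + |t|) ≤ ‖fderiv ℝ g w v - t • e w‖ :=
    exists_transversality_margin hKbc hdgc hec hgimm hetan
  obtain ⟨θg, hθg, hθgle⟩ := exists_oscillation_lt hKbc hdgc (show 0 < cg / 2 by positivity)
  obtain ⟨γg, hγg, hγgle⟩ := exists_injectivity_margin hKbc hgc hginj hθg
  -- ### the second component of the actual field on the collar
  have he2 : ∀ w ∈ Col₀, mr / 2 ≤ ‖(e w).2‖ := by
    intro w hw
    have h1 := hmrle w hw
    have h2 : ‖(e w).2 - (e_ref w).2‖ ≤ δ₀ :=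
      (norm_snd_le (e w - e_ref w)).trans (heclose w hw.1 hw.2)
    have := norm_sub_norm_le (e_ref w).2 (e w).2
    rw [norm_sub_rev] at h2
    linarith only [h1, h2, this, hδ₀m]
  have he2ne : ∀ w ∈ Col₀, (e w).2 ≠ 0 := fun w hw h0 => by
    have := he2 w hw; rw [h0, norm_zero] at this; linarith only [this, hmr]
  have hwind' : wind (fun t => (e (circleLoop 0 (s - θ₀) t)).2) = N := by
    rw [← hwind]
    have hcirc : ∀ t, circleLoop 0 (s - θ₀) t ∈ Col₀ := by
      intro t
      have := norm_circleLoop_sub_center 0 (s - θ₀) t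
      rw [sub_zero, abs_of_pos (by linarith only [hθ₀s])] at this
      exact ⟨this.ge, by rw [this]; linarith only [hθ₀]⟩
    refine wind_eq_of_norm_sub_lt ?_ (by simp only [circleLoop_zero_eq]) ?_ ?_
    · exact (continuous_snd.comp_continuousOn (hec.comp (continuous_circleLoop 0 _).continuousOn
        fun t _ => hCol₀K (hcirc t)))
    · refine ⟨continuous_snd.comp_continuousOn (he_ref.comp (continuous_circleLoop 0 _).continuousOn
        fun t _ => hcirc t), fun t _ => ?_, by simp only [circleLoop_zero_eq]⟩
      exact norm_pos_iff.1 (hmr.trans_le (hmrle _ (hcirc t)))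
    · intro t _
      have hw := hcirc t
      have h2 : ‖(e (circleLoop 0 (s - θ₀) t)).2 - (e_ref (circleLoop 0 (s - θ₀) t)).2‖ ≤ δ₀ :=
        (norm_snd_le (e _ - e_ref _)).trans (heclose _ hw.1 hw.2)
      have := hmrle _ hw
      linarith only [h2, this, hδ₀m, hmr]
  -- ### the designed field
  obtain ⟨et₂, Z₂, D₂, a, ha, haρ, hetc, hetq, het1, hZloc, hZiff, hZcard, hZD, hZsign⟩ :=
    exists_designField (s := s) (ρ₁ := s - θ₀) (ρ₂ := s - θ₀ / 2) (by linarith only [hθ₀, hθ₀s])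
      (by linarith only [hθ₀, hθ₀s]) (by linarith only [hθ₀, hθ₀s]) (q := fun w => (e w).2)
      (continuous_snd.comp_continuousOn (hec.mono fun w hw => hCol₀K hw))
      (fun w h1 h2 => he2ne w ⟨h1, h2⟩) hwind'
  -- ### bounds
  obtain ⟨Me, hMe⟩ : ∃ M, ∀ w ∈ Kb, ‖e w‖ ≤ M := hKbc.exists_bound_of_continuousOn hec
  obtain ⟨Mt, hMt⟩ : ∃ M, ∀ w ∈ Kb, ‖et₂ w‖ ≤ M := hKbc.exists_bound_of_continuousOn hetc
  have hMe0 : 0 ≤ Me := (norm_nonneg _).trans (hMe 0 (mem_closedBall_self hs.le))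
  have hMt0 : 0 ≤ Mt := (norm_nonneg _).trans (hMt 0 (mem_closedBall_self hs.le))
  set L : ℝ := Me + Mt + 1 with hL
  have hLpos : 0 < L := by positivity
  obtain ⟨β, hβ, hβle⟩ := Literature.Analysis.Calculus.exists_pos_forall_le_of_finset S
    (fun μ => ‖C μ‖ * a ^ m μ / 2) (fun μ hμ => by
      have := norm_pos_iff.2 (hC μ hμ); positivity)
  -- ### the size of the push-off
  set ε : ℝ := min (γF / (4 * L)) (min (γg / (2 * L)) (β / (2 * (Mt + 1)))) with hε
  have hεpos : 0 < ε := lt_min (by positivity) (lt_min (by positivity) (by positivity))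
  have hεF : ε * L ≤ γF / 4 := by
    have h : ε ≤ γF / (4 * L) := min_le_left _ _
    rw [le_div_iff₀ (by positivity)] at h
    have h' : ε * (4 * L) = 4 * (ε * L) := by ring
    rw [h'] at h; linarith only [h]
  have hεg : ε * L ≤ γg / 2 := by
    have h : ε ≤ γg / (2 * L) := (min_le_right _ _).trans (min_le_left _ _)
    rw [le_div_iff₀ (by positivity)] at h
    have h' : ε * (2 * L) = 2 * (ε * L) := by ring
    rw [h'] at h; linarith only [h]
  have hεβ : ε * Mt < β := by
    have h : ε ≤ β / (2 * (Mt + 1)) := (min_le_right _ _).trans (min_le_right _ _)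
    rw [le_div_iff₀ (by positivity)] at h
    have h' : ε * (2 * (Mt + 1)) = 2 * (ε * Mt) + 2 * ε := by ring
    rw [h'] at h
    have := mul_nonneg hεpos.le hMt0
    linarith only [h, this, hεpos]
  have hεMe : ε * Me ≤ ε * L := mul_le_mul_of_nonneg_left (by linarith only [hL, hMt0]) hεpos.le
  have hεMeMt : ε * (Me + Mt) ≤ ε * L := mul_le_mul_of_nonneg_left (by linarith only [hL]) hεpos.le
  -- ### the model map
  set Q : ℂ × ℂ → ℂ := fun p => ∑ μ' ∈ S,
      -C μ' * p.1 ^ (m μ' - (k - 1)) * ∏ ν ∈ Rk.erase μ', (p.2 - ν * p.1) / (μ' - ν) with hQ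
  have hQd : Differentiable ℂ Q := differentiable_interpolant
  have hQc : Continuous Q := hQd.continuous
  have hQline : ∀ μ ∈ S, ∀ z, Q (z, μ * z) = -C μ * z ^ m μ := fun μ hμ z =>
    interpolant_line hk0 hm hμ z
  have hQdiag : ∀ z, Q (z, z) = 0 := fun z => interpolant_diag z
  set Φm : ℂ × ℂ → ℂ × ℂ := fun p => (p.1 ^ k - p.2 ^ k, Q p - ε * et₂ p.2) with hΦm
  obtain ⟨Zm, A, hZm, hZmin, hAm, hdetm, hsumm⟩ := model_package hk hC hm (Q := Q) (fun p => rfl)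
    (e₂ := et₂) (Z₂ := Z₂) (D₂ := D₂) (a := a) (s := s) (N := N) ha (by linarith only [haρ, hθ₀]) het1
    (fun w hw => hZiff w hw) (fun w hw => by linarith only [(hZloc w hw).2, hθ₀]) hZD hZsign hZcard
    (M := Mt) hεpos (fun w hw => hMt w (mem_closedBall_zero_iff.2 hw))
    (fun μ hμ => by
      have h1 := hβle μ hμ
      have h2 : 0 < ‖C μ‖ * a ^ m μ := by have := norm_pos_iff.2 (hC μ hμ); positivity
      linarith only [h1, h2, hεβ]) (Φ := Φm) (fun p => rfl)
  -- ### the homotopy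
  set τ₁ : ℝ → ℝ := fun t => max 0 (min 1 (3 * t)) with hτ₁
  set τ₂ : ℝ → ℝ := fun t => max 0 (min 1 (3 * t - 1)) with hτ₂
  set τ₃ : ℝ → ℝ := fun t => max 0 (min 1 (3 * t - 2)) with hτ₃
  have hτ₁c : Continuous τ₁ := continuous_clamp.comp (continuous_const.mul continuous_id)
  have hτ₂c : Continuous τ₂ := continuous_clamp.comp ((continuous_const.mul continuous_id).sub continuous_const)
  have hτ₃c : Continuous τ₃ := continuous_clamp.comp ((continuous_const.mul continuous_id).sub continuous_const)
  have hτmem : ∀ t, τ₁ t ∈ Icc (0 : ℝ) 1 ∧ τ₂ t ∈ Icc (0 : ℝ) 1 ∧ τ₃ t ∈ Icc (0 : ℝ) 1 := fun t =>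
    ⟨⟨le_max_left _ _, max_le zero_le_one (min_le_left _ _)⟩,
      ⟨le_max_left _ _, max_le zero_le_one (min_le_left _ _)⟩,
      ⟨le_max_left _ _, max_le zero_le_one (min_le_left _ _)⟩⟩
  set hmap : ℝ → ℂ → ℂ × ℂ := fun t x => F x + (τ₃ t) • (g x - F x) with hhmap
  set Ef : ℝ → ℂ → ℂ × ℂ := fun t w =>
    (((τ₂ t : ℝ) : ℂ) * (e w).1, ((1 - τ₂ t : ℝ) : ℂ) * et₂ w + ((τ₂ t : ℝ) : ℂ) * (e w).2) with hEf
  set Fh : ℝ → ℂ × ℂ → ℂ × ℂ := fun t p =>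
    (hmap t p.1 - hmap t p.2) - ε • Ef t p.2 +
      ((0 : ℂ), ((1 - τ₁ t : ℝ) : ℂ) * (Q p - (û p.1 - û p.2))) with hFh
  -- values of the clamps
  have hτ₂0 : ∀ t, t ≤ 1 / 3 → τ₂ t = 0 := fun t ht => clamp_of_le_zero (by linarith only [ht])
  have hτ₃0 : ∀ t, t ≤ 2 / 3 → τ₃ t = 0 := fun t ht => clamp_of_le_zero (by linarith only [ht])
  have hτ₁1 : ∀ t, 1 / 3 ≤ t → τ₁ t = 1 := fun t ht => clamp_of_one_le (by linarith only [ht])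
  have hτ₂1 : ∀ t, 2 / 3 ≤ t → τ₂ t = 1 := fun t ht => clamp_of_one_le (by linarith only [ht])
  have hτ₃1 : τ₃ 1 = 1 := clamp_of_one_le (by norm_num)
  have hτ₁0 : τ₁ 0 = 0 := clamp_of_le_zero (by norm_num)
  -- the end maps
  have hFh0 : Fh 0 = Φm := by
    funext p
    have h2 : τ₂ 0 = 0 := hτ₂0 0 (by norm_num)
    have h3 : τ₃ 0 = 0 := hτ₃0 0 (by norm_num)
    have hL' : Fh 0 p = (F p.1 - F p.2) - ε • (((0 : ℂ), et₂ p.2) : ℂ × ℂ) +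
        (((0 : ℂ), Q p - (û p.1 - û p.2)) : ℂ × ℂ) := by
      simp only [hFh, hhmap, hEf, hτ₁0, h2, h3, zero_smul, add_zero, ofReal_zero, zero_mul,
        sub_zero, ofReal_one, one_mul]
    rw [hL']
    change _ = (p.1 ^ k - p.2 ^ k, Q p - ε * et₂ p.2)
    ext
    · simp [hFdef]
    · simp only [hFdef, Prod.snd_add, Prod.snd_sub, Prod.smul_snd, real_smul]; ring
  have hFh1 : ∀ p, Fh 1 p = g p.1 - g p.2 - ε • e p.2 := by
    intro p
    simp only [hFh, hhmap, hEf, hτ₁1 1 (by norm_num), hτ₂1 1 (by norm_num), hτ₃1, one_smul,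
      add_sub_cancel, ofReal_one, one_mul, sub_self, ofReal_zero, zero_mul, zero_add, Prod.mk.eta,
      add_eq_left, Prod.mk_eq_zero, true_and]
  -- ### geometry of the bidisc
  have hball1 : ∀ p : ℂ × ℂ, p ∈ ball (0 : ℂ × ℂ) s → p.1 ∈ Kb := fun p hp =>
    mem_closedBall_zero_iff.2 ((norm_fst_le p).trans (mem_ball_zero_iff.1 hp).le)
  have hball2 : ∀ p : ℂ × ℂ, p ∈ ball (0 : ℂ × ℂ) s → p.2 ∈ Kb := fun p hp =>
    mem_closedBall_zero_iff.2 ((norm_snd_le p).trans (mem_ball_zero_iff.1 hp).le)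
  -- near-diagonal pairs outside the smaller bidisc have their second point in the collar
  have hcollar : ∀ p : ℂ × ℂ, p ∈ ball (0 : ℂ × ℂ) s → ¬ ‖p‖ ≤ s - θ₀ / 4 →
      ‖p.1 - p.2‖ < θd → s - θ₀ / 2 ≤ ‖p.2‖ := by
    intro p hp hnot hnear
    push Not at hnot
    rw [Prod.norm_def] at hnot
    rcases lt_max_iff.1 hnot with h | h
    · have := norm_sub_norm_le p.1 p.2
      linarith only [this, h, hnear, hθdθ₀]
    · linarith only [h, hθ₀]
  -- ### continuity of the homotopy
  have hcontFh : ContinuousOn (fun q : ℝ × (ℂ × ℂ) => Fh q.1 q.2) (univ ×ˢ ball (0 : ℂ × ℂ) s) := by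
    have hp1 : ∀ q : ℝ × (ℂ × ℂ), q ∈ univ ×ˢ ball (0 : ℂ × ℂ) s → q.2.1 ∈ Kb := fun q hq => hball1 q.2 hq.2
    have hp2 : ∀ q : ℝ × (ℂ × ℂ), q ∈ univ ×ˢ ball (0 : ℂ × ℂ) s → q.2.2 ∈ Kb := fun q hq => hball2 q.2 hq.2
    have c1 : Continuous fun q : ℝ × (ℂ × ℂ) => q.2.1 := continuous_fst.comp continuous_snd
    have c2 : Continuous fun q : ℝ × (ℂ × ℂ) => q.2.2 := continuous_snd.comp continuous_snd
    have hF1 : ContinuousOn (fun q : ℝ × (ℂ × ℂ) => F q.2.1) (univ ×ˢ ball 0 s) := hFc.comp c1.continuousOn hp1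
    have hF2 : ContinuousOn (fun q : ℝ × (ℂ × ℂ) => F q.2.2) (univ ×ˢ ball 0 s) := hFc.comp c2.continuousOn hp2
    have hg1' : ContinuousOn (fun q : ℝ × (ℂ × ℂ) => g q.2.1) (univ ×ˢ ball 0 s) := hgc.comp c1.continuousOn hp1
    have hg2' : ContinuousOn (fun q : ℝ × (ℂ × ℂ) => g q.2.2) (univ ×ˢ ball 0 s) := hgc.comp c2.continuousOn hp2
    have he2' : ContinuousOn (fun q : ℝ × (ℂ × ℂ) => e q.2.2) (univ ×ˢ ball 0 s) := hec.comp c2.continuousOn hp2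
    have het2' : ContinuousOn (fun q : ℝ × (ℂ × ℂ) => et₂ q.2.2) (univ ×ˢ ball 0 s) := hetc.comp c2.continuousOn hp2
    have hû1 : ContinuousOn (fun q : ℝ × (ℂ × ℂ) => û q.2.1) (univ ×ˢ ball 0 s) :=
      (hû.continuousOn.mono hsU).comp c1.continuousOn hp1
    have hû2 : ContinuousOn (fun q : ℝ × (ℂ × ℂ) => û q.2.2) (univ ×ˢ ball 0 s) :=
      (hû.continuousOn.mono hsU).comp c2.continuousOn hp2
    have hQ' : ContinuousOn (fun q : ℝ × (ℂ × ℂ) => Q q.2) (univ ×ˢ ball 0 s) :=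
      (hQc.comp continuous_snd).continuousOn
    have ht3 : Continuous fun q : ℝ × (ℂ × ℂ) => τ₃ q.1 := hτ₃c.comp continuous_fst
    have ht2 : Continuous fun q : ℝ × (ℂ × ℂ) => ((τ₂ q.1 : ℝ) : ℂ) := continuous_ofReal.comp (hτ₂c.comp continuous_fst)
    have ht2' : Continuous fun q : ℝ × (ℂ × ℂ) => ((1 - τ₂ q.1 : ℝ) : ℂ) :=
      continuous_ofReal.comp (continuous_const.sub (hτ₂c.comp continuous_fst))
    have ht1' : Continuous fun q : ℝ × (ℂ × ℂ) => ((1 - τ₁ q.1 : ℝ) : ℂ) :=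
      continuous_ofReal.comp (continuous_const.sub (hτ₁c.comp continuous_fst))
    have hh1 : ContinuousOn (fun q : ℝ × (ℂ × ℂ) => hmap q.1 q.2.1) (univ ×ˢ ball 0 s) :=
      hF1.add (ht3.continuousOn.smul (hg1'.sub hF1))
    have hh2 : ContinuousOn (fun q : ℝ × (ℂ × ℂ) => hmap q.1 q.2.2) (univ ×ˢ ball 0 s) :=
      hF2.add (ht3.continuousOn.smul (hg2'.sub hF2))
    have hE : ContinuousOn (fun q : ℝ × (ℂ × ℂ) => Ef q.1 q.2.2) (univ ×ˢ ball 0 s) := by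
      refine ContinuousOn.prodMk ?_ ?_
      · exact ht2.continuousOn.mul (continuous_fst.comp_continuousOn he2')
      · exact (ht2'.continuousOn.mul het2').add (ht2.continuousOn.mul (continuous_snd.comp_continuousOn he2'))
    have hlast : ContinuousOn (fun q : ℝ × (ℂ × ℂ) =>
        (((0 : ℂ), ((1 - τ₁ q.1 : ℝ) : ℂ) * (Q q.2 - (û q.2.1 - û q.2.2))) : ℂ × ℂ)) (univ ×ˢ ball 0 s) :=
      continuousOn_const.prodMk (ht1'.continuousOn.mul (hQ'.sub (hû1.sub hû2)))
    have hEε : ContinuousOn (fun q : ℝ × (ℂ × ℂ) => ε • Ef q.1 q.2.2) (univ ×ˢ ball 0 s) :=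
      (continuousOn_const (c := ε)).smul hE
    have hmain : ContinuousOn (fun q : ℝ × (ℂ × ℂ) => (hmap q.1 q.2.1 - hmap q.1 q.2.2) - ε • Ef q.1 q.2.2 +
        (((0 : ℂ), ((1 - τ₁ q.1 : ℝ) : ℂ) * (Q q.2 - (û q.2.1 - û q.2.2))) : ℂ × ℂ)) (univ ×ˢ ball 0 s) :=
      ((hh1.sub hh2).sub hEε).add hlast
    exact hmain
  -- ### zeros of the homotopy stay in the smaller closed bidisc
  have hzeros : ∀ t ∈ Icc (0 : ℝ) 1, ∀ p ∈ ball (0 : ℂ × ℂ) s, Fh t p = 0 →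
      p ∈ closedBall (0 : ℂ × ℂ) (s - θ₀ / 4) := by
    intro t ht p hp h0
    rw [mem_closedBall_zero_iff]
    by_contra hout
    have hz : p.1 ∈ Kb := hball1 p hp
    have hw : p.2 ∈ Kb := hball2 p hp
    have hws : ‖p.2‖ ≤ s := mem_closedBall_zero_iff.1 hw
    have hzs : ‖p.1‖ ≤ s := mem_closedBall_zero_iff.1 hz
    rcases le_or_gt t (1 / 3) with ht1 | ht1
    · -- ## stage of the second component: zeros lie on the lines `w = μ z`
      have h2 : τ₂ t = 0 := hτ₂0 t ht1
      have h3 : τ₃ t = 0 := hτ₃0 t (by linarith only [ht1])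
      have hfst : p.1 ^ k = p.2 ^ k := by
        have := congrArg Prod.fst h0
        simp only [hFh, hhmap, hEf, h2, h3, zero_smul, add_zero, Prod.fst_add, Prod.fst_sub,
          Prod.smul_fst, ofReal_zero, zero_mul, smul_zero, sub_zero, Prod.fst_zero, hFdef] at this
        exact sub_eq_zero.1 this
      have hsnd : ((τ₁ t : ℝ) : ℂ) * (û p.1 - û p.2) + ((1 - τ₁ t : ℝ) : ℂ) * Q p - ε * et₂ p.2 = 0 := by
        have := congrArg Prod.snd h0
        simp only [hFh, hhmap, hEf, h2, h3, zero_smul, add_zero, Prod.snd_add, Prod.snd_sub,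
          Prod.smul_snd, ofReal_zero, zero_mul, sub_zero, Prod.snd_zero, hFdef, ofReal_one,
          one_mul, real_smul] at this
        rw [← this]; push_cast; ring
      -- `p.1 ≠ 0`
      have hp10 : p.1 ≠ 0 := by
        intro hz0
        have hw0 : p.2 = 0 := by
          rw [hz0, zero_pow hk0.ne'] at hfst
          exact (pow_eq_zero_iff hk0.ne').1 hfst.symm
        have hQ0 : Q p = 0 := by
          have : p = (0, 0) := Prod.ext hz0 hw0
          rw [this]; exact hQdiag 0
        rw [hQ0, hz0, hw0, het1 0 (by rw [norm_zero]; exact ha.le)] at hsnd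
        simp only [sub_self, mul_zero, add_zero, mul_one, zero_sub, neg_eq_zero] at hsnd
        exact (ofReal_ne_zero.2 hεpos.ne') hsnd
      set μ := p.2 / p.1 with hμ
      have hμR : μ ∈ Rk := by
        refine (Polynomial.mem_nthRootsFinset hk0 (1 : ℂ)).2 ?_
        rw [hμ, div_pow, ← hfst, div_self (pow_ne_zero _ hp10)]
      have hp2μ : p.2 = μ * p.1 := by rw [hμ]; field_simp
      by_cases hμ1 : μ = 1
      · -- diagonal zeros are the designed ones, deep inside
        rw [hμ1, one_mul] at hp2μ
        have hQ0 : Q p = 0 := by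
          have : p = (p.1, p.1) := Prod.ext rfl hp2μ
          rw [this]; exact hQdiag p.1
        rw [hQ0, hp2μ, sub_self, mul_zero, mul_zero, zero_add, zero_sub, neg_eq_zero,
          mul_eq_zero] at hsnd
        rcases hsnd with h | h
        · exact (ofReal_ne_zero.2 hεpos.ne') h
        · have hmem := (hZiff p.1 hzs).1 h
          have := (hZloc p.1 hmem).2
          apply hout
          rw [Prod.norm_def, hp2μ, max_self]; linarith only [this, hθ₀]
      · -- branch zeros are tiny
        have hμS : μ ∈ S := Finset.mem_erase.2 ⟨hμ1, hμR⟩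
        have hμn : ‖μ‖ = 1 := Complex.norm_eq_one_of_pow_eq_one
          ((Polynomial.mem_nthRootsFinset hk0 (1 : ℂ)).1 hμR) hk0.ne'
        have hQp : Q p = -C μ * p.1 ^ m μ := by
          have : p = (p.1, μ * p.1) := Prod.ext rfl hp2μ
          rw [this]; exact hQline μ hμS p.1
        rw [hQp, hp2μ] at hsnd
        -- sizes
        have hza : a ≤ ‖p.1‖ := by
          by_contra hlt; push Not at hlt
          apply hout
          rw [Prod.norm_def, hp2μ, norm_mul, hμn, one_mul, max_self]; linarith only [hlt, haρ, hθ₀]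
        have hal := halign μ hμS p.1 hzs
        set r := û p.1 - û (μ * p.1) + C μ * p.1 ^ m μ with hr
        have hmain : ‖((τ₁ t : ℝ) : ℂ) * (û p.1 - û (μ * p.1)) + ((1 - τ₁ t : ℝ) : ℂ) * (-C μ * p.1 ^ m μ)‖
            ≥ ‖C μ‖ * ‖p.1‖ ^ m μ / 2 := by
          have heq : ((τ₁ t : ℝ) : ℂ) * (û p.1 - û (μ * p.1)) + ((1 - τ₁ t : ℝ) : ℂ) * (-C μ * p.1 ^ m μ)
              = -(C μ * p.1 ^ m μ) + ((τ₁ t : ℝ) : ℂ) * r := by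
            rw [hr]; push_cast; ring
          rw [heq]
          have h1 : ‖((τ₁ t : ℝ) : ℂ) * r‖ ≤ ‖C μ‖ * ‖p.1‖ ^ m μ / 2 := by
            rw [norm_mul, norm_real, Real.norm_of_nonneg (hτmem t).1.1]
            calc τ₁ t * ‖r‖ ≤ 1 * ‖r‖ := mul_le_mul_of_nonneg_right (hτmem t).1.2 (norm_nonneg _)
              _ ≤ _ := by rw [one_mul]; exact hal
          have h2 : ‖-(C μ * p.1 ^ m μ)‖ = ‖C μ‖ * ‖p.1‖ ^ m μ := by rw [norm_neg, norm_mul, norm_pow]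
          have h3 : ‖-(C μ * p.1 ^ m μ)‖ ≤ ‖-(C μ * p.1 ^ m μ) + ((τ₁ t : ℝ) : ℂ) * r‖ +
              ‖((τ₁ t : ℝ) : ℂ) * r‖ := by
            have := norm_add_le (-(C μ * p.1 ^ m μ) + ((τ₁ t : ℝ) : ℂ) * r) (-(((τ₁ t : ℝ) : ℂ) * r))
            rw [add_neg_cancel_right] at this
            simpa only [norm_neg] using this
          rw [h2] at h3
          linarith only [h1, h3]
        have hsmallε : ‖(ε : ℂ) * et₂ (μ * p.1)‖ < ‖C μ‖ * ‖p.1‖ ^ m μ / 2 := by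
          rw [norm_mul, norm_real, Real.norm_of_nonneg hεpos.le]
          have h1 : ‖et₂ (μ * p.1)‖ ≤ Mt := hMt _ (by
            rw [hKb, mem_closedBall_zero_iff, norm_mul, hμn, one_mul]; exact hzs)
          have h2 : ‖C μ‖ * a ^ m μ / 2 ≤ ‖C μ‖ * ‖p.1‖ ^ m μ / 2 := by
            have h := mul_le_mul_of_nonneg_left (pow_le_pow_left₀ ha.le hza (m μ)) (norm_nonneg (C μ))
            linarith only [h]
          calc ε * ‖et₂ (μ * p.1)‖ ≤ ε * Mt := mul_le_mul_of_nonneg_left h1 hεpos.le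
            _ < β := hεβ
            _ ≤ ‖C μ‖ * a ^ m μ / 2 := hβle μ hμS
            _ ≤ _ := h2
        have heq0 : ((τ₁ t : ℝ) : ℂ) * (û p.1 - û (μ * p.1)) + ((1 - τ₁ t : ℝ) : ℂ) * (-C μ * p.1 ^ m μ)
            = ε * et₂ (μ * p.1) := by rw [← sub_eq_zero]; exact hsnd
        rw [heq0] at hmain
        exact lt_irrefl _ (hsmallε.trans_le hmain)
    · -- ## the two push-off stages: near-diagonal zeros sit over the collar
      -- common facts
      have h1' : τ₁ t = 1 := hτ₁1 t ht1.le
      have hnear_or_far := le_or_gt θd ‖p.1 - p.2‖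
      rcases le_or_gt t (2 / 3) with ht2 | ht2
      · -- # field homotopy, map `F`
        have h3 : τ₃ t = 0 := hτ₃0 t ht2
        have hzero : F p.1 - F p.2 = ε • Ef t p.2 := by
          have := h0
          simp only [hFh, hhmap, h1', h3, zero_smul, add_zero, sub_self, ofReal_zero, zero_mul] at this
          rw [Prod.mk_zero_zero, add_zero, sub_eq_zero] at this
          exact this
        have hEbound : ‖Ef t p.2‖ ≤ Me + Mt := by
          simp only [hEf, Prod.norm_def]
          have hτ := (hτmem t).2.1
          have he' := hMe p.2 hw
          have h1 : ‖((τ₂ t : ℝ) : ℂ) * (e p.2).1‖ ≤ Me := by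
            rw [norm_mul, norm_real, Real.norm_of_nonneg hτ.1]
            calc τ₂ t * ‖(e p.2).1‖ ≤ 1 * ‖e p.2‖ :=
                  mul_le_mul hτ.2 (norm_fst_le _) (norm_nonneg _) zero_le_one
              _ ≤ Me := by rw [one_mul]; exact he'
          have h2 : ‖((1 - τ₂ t : ℝ) : ℂ) * et₂ p.2 + ((τ₂ t : ℝ) : ℂ) * (e p.2).2‖ ≤ Mt + Me := by
            refine (norm_add_le _ _).trans (add_le_add ?_ ?_)
            · rw [norm_mul, norm_real, Real.norm_of_nonneg (sub_nonneg.2 hτ.2)]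
              calc (1 - τ₂ t) * ‖et₂ p.2‖ ≤ 1 * ‖et₂ p.2‖ :=
                    mul_le_mul_of_nonneg_right (sub_le_self 1 hτ.1) (norm_nonneg _)
                _ ≤ Mt := by rw [one_mul]; exact hMt p.2 hw
            · rw [norm_mul, norm_real, Real.norm_of_nonneg hτ.1]
              calc τ₂ t * ‖(e p.2).2‖ ≤ 1 * ‖e p.2‖ :=
                    mul_le_mul hτ.2 (norm_snd_le _) (norm_nonneg _) zero_le_one
                _ ≤ Me := by rw [one_mul]; exact he'
          exact max_le (h1.trans (le_add_of_nonneg_right hMt0)) (h2.trans_eq (add_comm Mt Me))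
        rcases hnear_or_far with hfar | hnear
        · -- far pairs: injectivity margin
          have h1 := hγFle p.1 hz p.2 hw hfar
          rw [hzero, norm_smul, Real.norm_of_nonneg hεpos.le] at h1
          have : ε * ‖Ef t p.2‖ ≤ ε * (Me + Mt) := mul_le_mul_of_nonneg_left hEbound hεpos.le
          linarith only [h1, this, hεMeMt, hεF, hγF]
        · -- near pairs: transversality on the collar
          have hwcol : s - θ₀ / 2 ≤ ‖p.2‖ := hcollar p hp hout hnear
          have hwCol₀ : p.2 ∈ Col₀ := ⟨by linarith only [hwcol, hθ₀], hws⟩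
          have hetw : et₂ p.2 = (e p.2).2 := hetq p.2 hwcol hws
          have hE : Ef t p.2 = ((((τ₂ t : ℝ) : ℂ) * (e p.2).1), (e p.2).2) := by
            simp only [hEf, hetw]; ext <;> push_cast <;> ring
          -- the margin
          have hmargin : ∀ (v : ℂ) (t' : ℝ), (c₁ - δ₀) * (‖v‖ + |t'|) ≤ ‖fderiv ℝ F p.2 v - t' • Ef t p.2‖ := by
            intro v t'
            have hb := hc₁le (p.2, τ₂ t) ⟨hwCol₀, (hτmem t).2.1⟩ v t'
            have hdiff : ‖Ef t p.2 - ((((τ₂ t : ℝ) : ℂ) * (e_ref p.2).1), (e_ref p.2).2)‖ ≤ δ₀ := by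
              rw [hE, Prod.norm_def]
              have hcl := heclose p.2 hwCol₀.1 hwCol₀.2
              refine max_le ?_ ?_
              · show ‖((τ₂ t : ℝ) : ℂ) * (e p.2).1 - ((τ₂ t : ℝ) : ℂ) * (e_ref p.2).1‖ ≤ δ₀
                rw [← mul_sub, norm_mul, norm_real, Real.norm_of_nonneg (hτmem t).2.1.1]
                calc τ₂ t * ‖(e p.2).1 - (e_ref p.2).1‖ ≤ 1 * ‖e p.2 - e_ref p.2‖ :=
                      mul_le_mul (hτmem t).2.1.2 (norm_fst_le (e p.2 - e_ref p.2)) (norm_nonneg _)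
                        zero_le_one
                  _ ≤ δ₀ := by rw [one_mul]; exact hcl
              · show ‖(e p.2).2 - (e_ref p.2).2‖ ≤ δ₀
                exact (norm_snd_le (e p.2 - e_ref p.2)).trans hcl
            have htri : ‖fderiv ℝ F p.2 v - t' • ((((τ₂ t : ℝ) : ℂ) * (e_ref p.2).1), (e_ref p.2).2)‖ ≤
                ‖fderiv ℝ F p.2 v - t' • Ef t p.2‖ + |t'| * δ₀ := by
              have := norm_sub_le (fderiv ℝ F p.2 v - t' • Ef t p.2)
                (t' • (((((τ₂ t : ℝ) : ℂ) * (e_ref p.2).1), (e_ref p.2).2) - Ef t p.2))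
              rw [show fderiv ℝ F p.2 v - t' • Ef t p.2 -
                  t' • (((((τ₂ t : ℝ) : ℂ) * (e_ref p.2).1), (e_ref p.2).2) - Ef t p.2) =
                  fderiv ℝ F p.2 v - t' • ((((τ₂ t : ℝ) : ℂ) * (e_ref p.2).1), (e_ref p.2).2) by
                  rw [smul_sub]; abel] at this
              refine this.trans (add_le_add le_rfl ?_)
              rw [norm_smul, Real.norm_eq_abs, ← norm_neg, neg_sub]
              exact mul_le_mul_of_nonneg_left hdiff (abs_nonneg _)
            linarith only [hb, htri, mul_nonneg hδ₀pos.le (norm_nonneg v)]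
          have hosc : ∀ x ∈ Kb ∩ closedBall p.2 θd, ‖fderiv ℝ F x - fderiv ℝ F p.2‖ ≤ c₁ / 4 := by
            intro x hx
            refine hθFle x hx.1 p.2 hw ?_
            have := mem_closedBall.1 hx.2
            rw [dist_eq_norm] at this
            exact this.trans hθdF
          refine ne_of_transversal ((convex_closedBall _ _).inter (convex_closedBall _ _))
            ⟨hz, mem_closedBall.2 (by rw [dist_eq_norm]; exact hnear.le)⟩
            ⟨hw, mem_closedBall_self hθd0.le⟩ (fun x hx => hFd x hx.1) hosc hmargin
            (by linarith only [hδ₀c, hc₁]) hεpos hzero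
      · -- # map homotopy, field `e`
        have h2 : τ₂ t = 1 := hτ₂1 t ht2.le
        set hτ : ℂ → ℂ × ℂ := fun x => F x + (τ₃ t) • (g x - F x) with hhτ
        have hzero : hτ p.1 - hτ p.2 = ε • e p.2 := by
          have := h0
          simp only [hFh, hhmap, hEf, h1', h2, sub_self, ofReal_zero, zero_mul, ofReal_one, one_mul,
            zero_add, Prod.mk.eta] at this
          have h00 : (((0 : ℂ), (0 : ℂ)) : ℂ × ℂ) = 0 := rfl
          rw [h00, add_zero, sub_eq_zero] at this
          exact this
        have hτt := (hτmem t).2.2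
        -- closeness of `hτ` to `F`
        have hclose : ∀ x ∈ Kb, ‖(hτ x - F x)‖ ≤ δ₀ := by
          intro x hx
          simp only [hhτ, add_sub_cancel_left, norm_smul, Real.norm_of_nonneg hτt.1]
          calc τ₃ t * ‖g x - F x‖ ≤ 1 * ‖g x - F x‖ := mul_le_mul_of_nonneg_right hτt.2 (norm_nonneg _)
            _ ≤ δ₀ := by rw [one_mul]; exact hg0 x hx
        rcases hnear_or_far with hfar | hnear
        · have h1 := hγFle p.1 hz p.2 hw hfar
          have htri : ‖F p.1 - F p.2‖ ≤ ‖hτ p.1 - hτ p.2‖ + δ₀ + δ₀ := by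
            have := norm_sub_le (hτ p.1 - hτ p.2) ((hτ p.1 - F p.1) - (hτ p.2 - F p.2))
            rw [show hτ p.1 - hτ p.2 - (hτ p.1 - F p.1 - (hτ p.2 - F p.2)) = F p.1 - F p.2 by abel] at this
            have h2 := norm_sub_le (hτ p.1 - F p.1) (hτ p.2 - F p.2)
            linarith only [this, h2, hclose p.1 hz, hclose p.2 hw]
          rw [hzero, norm_smul, Real.norm_of_nonneg hεpos.le] at htri
          have : ε * ‖e p.2‖ ≤ ε * Me := mul_le_mul_of_nonneg_left (hMe p.2 hw) hεpos.le
          linarith only [h1, htri, this, hεMe, hεF, hδ₀γ, hγF]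
        · have hwcol : s - θ₀ / 2 ≤ ‖p.2‖ := hcollar p hp hout hnear
          have hwCol₀ : p.2 ∈ Col₀ := ⟨by linarith only [hwcol, hθ₀], hws⟩
          -- the derivative of `hτ`
          have hhasτ : ∀ x ∈ Kb, HasFDerivAt hτ (fderiv ℝ F x + (τ₃ t) • (fderiv ℝ g x - fderiv ℝ F x)) x := by
            intro x hx
            exact (hFd x hx).hasFDerivAt.add (((hgd x hx).hasFDerivAt.sub (hFd x hx).hasFDerivAt).const_smul
              (τ₃ t))
          have hdhτ : ∀ x ∈ Kb, fderiv ℝ hτ x = fderiv ℝ F x + (τ₃ t) • (fderiv ℝ g x - fderiv ℝ F x) :=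
            fun x hx => (hhasτ x hx).fderiv
          have hdiffτ : ∀ x ∈ Kb, DifferentiableAt ℝ hτ x := fun x hx => (hhasτ x hx).differentiableAt
          -- margin
          have hmargin : ∀ (v : ℂ) (t' : ℝ), (c₁ - δ₀) * (‖v‖ + |t'|) ≤ ‖fderiv ℝ hτ p.2 v - t' • e p.2‖ := by
            intro v t'
            have hb := hc₁le (p.2, 1) ⟨hwCol₀, ⟨zero_le_one, le_rfl⟩⟩ v t'
            have heref : ((((1 : ℝ) : ℂ) * (e_ref p.2).1), (e_ref p.2).2) = e_ref p.2 := by simp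
            rw [heref] at hb
            rw [hdhτ p.2 hw]
            have hA : ‖((τ₃ t) • (fderiv ℝ g p.2 - fderiv ℝ F p.2)) v‖ ≤ δ₀ * ‖v‖ := by
              change ‖(τ₃ t) • ((fderiv ℝ g p.2 - fderiv ℝ F p.2) v)‖ ≤ _
              rw [norm_smul, Real.norm_of_nonneg hτt.1]
              calc τ₃ t * ‖(fderiv ℝ g p.2 - fderiv ℝ F p.2) v‖ ≤ 1 * (δ₀ * ‖v‖) := by
                    refine mul_le_mul hτt.2 ?_ (norm_nonneg _) zero_le_one
                    exact (ContinuousLinearMap.le_opNorm _ _).trans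
                      (mul_le_mul_of_nonneg_right (hg1 p.2 hw) (norm_nonneg _))
                _ = δ₀ * ‖v‖ := one_mul _
            have hB : ‖t' • (e p.2 - e_ref p.2)‖ ≤ |t'| * δ₀ := by
              rw [norm_smul, Real.norm_eq_abs]
              exact mul_le_mul_of_nonneg_left (heclose p.2 hwCol₀.1 hwCol₀.2) (abs_nonneg _)
            have htri : ‖fderiv ℝ F p.2 v - t' • e_ref p.2‖ ≤
                ‖(fderiv ℝ F p.2 + (τ₃ t) • (fderiv ℝ g p.2 - fderiv ℝ F p.2)) v - t' • e p.2‖ +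
                  δ₀ * ‖v‖ + |t'| * δ₀ := by
              have := norm_add₃_le (a := (fderiv ℝ F p.2 + (τ₃ t) • (fderiv ℝ g p.2 - fderiv ℝ F p.2)) v - t' • e p.2)
                (b := -(((τ₃ t) • (fderiv ℝ g p.2 - fderiv ℝ F p.2)) v)) (c := t' • (e p.2 - e_ref p.2))
              have hid : (fderiv ℝ F p.2 + (τ₃ t) • (fderiv ℝ g p.2 - fderiv ℝ F p.2)) v - t' • e p.2 +
                  -(((τ₃ t) • (fderiv ℝ g p.2 - fderiv ℝ F p.2)) v) + t' • (e p.2 - e_ref p.2) =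
                  fderiv ℝ F p.2 v - t' • e_ref p.2 := by
                change fderiv ℝ F p.2 v + (τ₃ t) • ((fderiv ℝ g p.2 - fderiv ℝ F p.2) v) - t' • e p.2 +
                  -((τ₃ t) • ((fderiv ℝ g p.2 - fderiv ℝ F p.2) v)) + t' • (e p.2 - e_ref p.2) =
                  fderiv ℝ F p.2 v - t' • e_ref p.2
                rw [smul_sub]; abel
              rw [hid, norm_neg] at this
              linarith only [this, hA, hB]
            linarith only [hb, htri]
          -- oscillation
          have hosc : ∀ x ∈ Kb ∩ closedBall p.2 θd, ‖fderiv ℝ hτ x - fderiv ℝ hτ p.2‖ ≤ c₁ / 2 := by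
            intro x hx
            have hxd : ‖x - p.2‖ ≤ θd := by
              have := mem_closedBall.1 hx.2; rwa [dist_eq_norm] at this
            rw [hdhτ x hx.1, hdhτ p.2 hw]
            have e1 : fderiv ℝ F x + (τ₃ t) • (fderiv ℝ g x - fderiv ℝ F x) -
                (fderiv ℝ F p.2 + (τ₃ t) • (fderiv ℝ g p.2 - fderiv ℝ F p.2)) =
                (fderiv ℝ F x - fderiv ℝ F p.2) + (τ₃ t) • ((fderiv ℝ g x - fderiv ℝ F x) -
                  (fderiv ℝ g p.2 - fderiv ℝ F p.2)) := by simp only [smul_sub]; abel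
            rw [e1]
            refine (norm_add_le _ _).trans ?_
            have hA := hθFle x hx.1 p.2 hw (hxd.trans hθdF)
            have hB : ‖(τ₃ t) • ((fderiv ℝ g x - fderiv ℝ F x) - (fderiv ℝ g p.2 - fderiv ℝ F p.2))‖ ≤ 2 * δ₀ := by
              rw [norm_smul, Real.norm_of_nonneg hτt.1]
              calc τ₃ t * ‖(fderiv ℝ g x - fderiv ℝ F x) - (fderiv ℝ g p.2 - fderiv ℝ F p.2)‖
                  ≤ 1 * (δ₀ + δ₀) := by
                    refine mul_le_mul hτt.2 ((norm_sub_le _ _).trans (add_le_add (hg1 x hx.1) (hg1 p.2 hw)))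
                      (norm_nonneg _) zero_le_one
                _ = 2 * δ₀ := by ring
            linarith only [hA, hB, hδ₀c]
          refine ne_of_transversal ((convex_closedBall _ _).inter (convex_closedBall _ _))
            ⟨hz, mem_closedBall.2 (by rw [dist_eq_norm]; exact hnear.le)⟩
            ⟨hw, mem_closedBall_self hθd0.le⟩ (fun x hx => hdiffτ x hx.1) hosc hmargin
            (by linarith only [hδ₀c, hc₁]) hεpos hzero
  -- ### the end map is zero-free
  have hend : ∀ p ∈ ball (0 : ℂ × ℂ) s, Fh 1 p ≠ 0 := by
    intro p hp h0
    have hz : p.1 ∈ Kb := hball1 p hp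
    have hw : p.2 ∈ Kb := hball2 p hp
    rw [hFh1 p, sub_eq_zero] at h0
    rcases le_or_gt θg ‖p.1 - p.2‖ with hfar | hnear
    · have h1 := hγgle p.1 hz p.2 hw hfar
      rw [h0, norm_smul, Real.norm_of_nonneg hεpos.le] at h1
      have : ε * ‖e p.2‖ ≤ ε * Me := mul_le_mul_of_nonneg_left (hMe p.2 hw) hεpos.le
      linarith only [h1, this, hεMe, hεg, hγg]
    · have hosc : ∀ x ∈ Kb ∩ closedBall p.2 θg, ‖fderiv ℝ g x - fderiv ℝ g p.2‖ ≤ cg / 2 := by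
        intro x hx
        refine hθgle x hx.1 p.2 hw ?_
        have := mem_closedBall.1 hx.2; rwa [dist_eq_norm] at this
      exact ne_of_transversal ((convex_closedBall _ _).inter (convex_closedBall _ _))
        ⟨hz, mem_closedBall.2 (by rw [dist_eq_norm]; exact hnear.le)⟩
        ⟨hw, mem_closedBall_self hθg.le⟩ (fun x hx => hgd x hx.1) hosc (hcgle p.2 hw)
        (by linarith only [hcg]) hεpos h0
  -- ### the degree theorem
  have hKO : closedBall (0 : ℂ × ℂ) (s - θ₀ / 4) ⊆ ball 0 s :=
    closedBall_subset_ball (by linarith only [hθ₀])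
  have hsum0 := sum_detSign_eq_zero_complexProd isOpen_ball (isCompact_closedBall _ _) hKO Fh
    hcontFh hzeros hend Zm (fun p hp => by rw [hFh0]; exact hZm p (mem_ball_zero_iff.1 hp))
    (fun p hp => mem_ball_zero_iff.2 (hZmin p hp)) A (fun p hp => by rw [hFh0]; exact hAm p hp) hdetm
  -- ### the count
  rw [hsumm] at hsum0
  have hSm : (∑ μ ∈ S, (m μ : ℤ)) = ((∑ μ ∈ S, m μ : ℕ) : ℤ) := by push_cast; rfl
  rw [hSm] at hsum0 hN
  have hNeq : N = -((∑ μ ∈ S, m μ : ℕ) : ℤ) := by linarith only [hsum0]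
  have : (N.natAbs : ℤ) = ((∑ μ ∈ S, m μ : ℕ) : ℤ) := by
    rw [hNeq, Int.natAbs_neg, Int.natAbs_natCast]
  linarith only [this, hN]

end CuspDoublePoints

end Literature.Geometry.Symplectic
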